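import Literature.MathematicalPhysics.QuantumLattice.XYZThermalGaussianDomination
import Literature.MathematicalPhysics.QuantumLattice.DuhamelTwoPointProofs
import HarnessLib

/-!
# Björnberg–Ueltschi: the infrared bound at positive temperature for the anisotropic
# nearest-neighbour model (Lemma 4.4 as printed, `β < ∞`)

Topic `MathematicalPhysics/QuantumLattice`; the positive-temperature twin of the `(A)` section of
`XYZGroundStateOrderProofs.lean` (`xyz_infraredBound_of_groundEnergy_le`, Lemma 4.4 at `β = ∞`).
No statement of the tree is changed and no named fact is introduced; everything here is a theorem.

J. E. Björnberg, D. Ueltschi, *Reflection positivity and infrared bounds for quantum spin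
systems* (2022) [BjornbergUeltschi2022], §4: for the Gibbs state `⟨·⟩ = ⟨·⟩_{Λ_ℓ,β,0}` of the
nearest-neighbour Hamiltonian with couplings `J⁽³⁾ = 1 ≥ J⁽¹⁾ ≥ -J⁽²⁾ ≥ 0`, Lemma 4.1 (infrared bound
for the Duhamel function, `η̂(k) ≤ 1/(2βε(k))`), Corollary 4.3 (Falk–Bruch) and (4.26)–(4.29) give
**Lemma 4.4**: "we have for all `k ∈ Λ*_ℓ ∖ {0}` that
`⟨S⁽³⁾_0 S⁽³⁾_x⟩^(k) ≤ √(e(k)/2ε(k)) + 1/(2βε(k))`", with `ε(k) = 2Σᵢ(1 - cos kᵢ)` and, for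
nearest-neighbour couplings, `e(k) = α_ℓ(β) Σᵢ(1 + r cos kᵢ)` ((4.33)–(4.34)).

As in the tree's ground-state files we work in the globally rotated frame
`H' = anisotropicTorus d L n 1 J₂ J₁` (B–U's axes `(1,2,3)` are our spin components `(2,1,0)`; the
order is studied along the FIRST component), with the generic thermal objects of
`HeisenbergOrderDLSInfrared.lean`: `gibbsSpinCorr β H' α x y = Re⟨Sᵅ_xSᵅ_y⟩_β`,
`gibbsStructureFactor β H' 0 q = ĝ_q`, `gibbsBondCorr β H' α = cᵅ(β)` (site and direction average
of the nearest-neighbour correlation; by the lattice symmetries it is the correlation of any one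
bond, `xyz_sum_gibbsSpinCorr_dir`).

## Contents

* (SYMᵀ) `xyz_gibbsSpinCorr_comp_perm`, `xyz_sum_gibbsSpinCorr_dir` — covariance of the Gibbs
  state under permutations of the coordinate axes; direction independence of the thermal bond
  correlations (B–U (4.33): "using lattice symmetries");
* (Eᵀ) `re_gibbsState_anisotropicTorus` — `Re⟨H(a,b,c)⟩_{β} = -2dL^d(a c⁰ + b c¹ + c c²)` for the
  Gibbs state of any torus Hamiltonian (used by the sequel for the thermal variational and orbit
  inequalities);
* (DCᵀ) `re_gibbsState_xyz_lie_lie(_modes)` — the Gibbs expectation of the double commutator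
  `[A,[H',A]]` of a real wave of the first component, B–U (4.28)–(4.29):
  `Re⟨[C_q,[H',C_q]]⟩ + Re⟨[D_q,[H',D_q]]⟩ = 4ΣᵢΣ_z((J₂ - J₁cos qᵢ)G¹ + (J₁ - J₂cos qᵢ)G²)(z,z+eᵢ)`;
* (Aᵀ) **`xyz_infraredBound_thermal_of_gd`** — thermal Gaussian domination
  `Z_β(H' - 2V⁰_h + Q(h)·1) ≤ Z_β(H')` for all real fields (the shape supplied by
  `bu_thermalGaussianDomination`) implies, for `L ≥ 3`, `d ≥ 1`, `β > 0` and every momentum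
  `q ≠ 0`: `0 ≤ ĝ_q` and
  `ĝ_q ≤ 1/(4βE_q) + ½ √(Σᵢ(α' - β'cos qᵢ)/E_q)`, `α' = J₂c¹ + J₁c²`, `β' = J₁c¹ + J₂c²`,
  `E_q = Σᵢ(1 - cos qᵢ)` (`dispersion`) — B–U Lemma 4.4 in the tree's normalisation
  (`ε(k) = 2E_k`; the `T = 0` bound of the tree is `ĝ_q² E_q ≤ ¼Σᵢ(α' - β'cos qᵢ)`). Proof as
  printed: Duhamel bound from Gaussian domination (`Matrix.gaussianDomination_duhamel_le_holds`,
  [DLS1978] (44)), the plane waves `V⁰_{cos} = 2E_q C_q`, `V⁰_{sin} = 2E_q D_q`, Falk–Bruch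
  (`Matrix.falkBruch_sum_le_of_le`, B–U Cor. 4.3), and (DCᵀ);
* **`xyz_infraredBound_thermal`** — the unconditional bound on even tori of side `L ≥ 4` for
  `0 ≤ J₁`, `J₂ ≤ 0`, every spin and every `β > 0`.

WHAT THIS IS NOT: no sum rule / long-range order (sequel `XYZThermalLongRangeOrder.lean`), no
correlation inequalities (sequel `XYZThermalCorrelationInequalities.lean`).

## References

* [BjornbergUeltschi2022] Lemma 4.1, Cor. 4.3, Lemma 4.4, eqs. (4.23)–(4.34), Cor. 5.3 / (5.20).
* [DLS1978] F. J. Dyson, E. H. Lieb, B. Simon, J. Stat. Phys. 18 (1978) 335–383, Thms. 3.1–3.2,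
  4.1, eq. (44).
* [KLS1988JSP] T. Kennedy, E. H. Lieb, B. S. Shastry, J. Stat. Phys. 53 (1988), eqs. (12)–(14)
  (the `T = 0` version), p. 1026.
-/

noncomputable section

open Matrix Finset Filter Topology
open scoped ComplexOrder
open Literature.MathematicalPhysics.QuantumLattice Literature.MathematicalPhysics.QuantumLattice.SpinOperators
  Literature.Probability.LatticeModels Literature.Barriers.AtomisticToContinuum.BoseGas

namespace Literature.MathematicalPhysics.QuantumLattice

variable {d : ℕ}

-- the commutator Lie-ring structure of an associative ring (Mathlib idiom, as in
-- `XYZGroundStateOrderProofs.lean`)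
attribute [local instance 100] LieRing.ofAssociativeRing

/-! ### (SYMᵀ) Axis permutations: direction independence of the thermal bond correlations -/

section AxisPermutation

variable {l m : Type*} [Fintype l] [Fintype m] [DecidableEq l] [DecidableEq m]

/-- The Gibbs state is covariant under a relabelling of the index set:
`⟨O∘(e×e)⟩_{β,A∘(e×e)} = ⟨O⟩_{β,A}`. [folklore] -/
private theorem gibbsState_submatrix_equiv_xyz (β : ℝ) (H A : Matrix m m ℂ) (e : l ≃ m) :
    gibbsState β (H.submatrix e e) (A.submatrix e e) = gibbsState β H A := by
  rw [gibbsState_apply, gibbsState_apply, Matrix.partitionFn_submatrix_equiv, gibbsWeight, gibbsWeight,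
    show -(β : ℂ) • H.submatrix e e = (-(β : ℂ) • H).submatrix e e from rfl,
    Matrix.exp_submatrix_equiv, submatrix_mul_equiv, Matrix.trace_submatrix_equiv]

variable (L : ℕ) [NeZero L] (n : ℕ) (β : ℝ) (J₁ J₂ : ℝ)

/-- **Covariance of the thermal two-point functions of `H'` under permutations of the axes**:
`Gᵅ_β(x∘s, y∘s) = Gᵅ_β(x, y)` (`H'` is invariant, `anisotropicTorus_submatrix_comp_perm`).
[cite: BjornbergUeltschi2022, (4.33) ("using lattice symmetries")] -/
theorem xyz_gibbsSpinCorr_comp_perm (s : Equiv.Perm (Fin d)) (α : Fin 3) (x y : TorusSite d L) :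
    gibbsSpinCorr β (anisotropicTorus d L n 1 J₂ J₁) α (x ∘ s) (y ∘ s) =
      gibbsSpinCorr β (anisotropicTorus d L n 1 J₂ J₁) α x y := by
  set π : TorusSite d L ≃ TorusSite d L := Equiv.arrowCongr s.symm (Equiv.refl (ZMod L)) with hπ
  have hH : (anisotropicTorus d L n 1 J₂ J₁).submatrix (fun σ => σ ∘ π) (fun σ => σ ∘ π) =
      anisotropicTorus d L n 1 J₂ J₁ :=
    anisotropicTorus_submatrix_comp_perm L n s 1 J₂ J₁
  have hO : (siteSpin n x α * siteSpin n y α).submatrix (fun σ => σ ∘ π) (fun σ => σ ∘ π) =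
      siteSpin n (x ∘ s) α * siteSpin n (y ∘ s) α := by
    rw [Matrix.submatrix_mul _ _ _ _ _ (bijective_comp_equiv (q := n + 1) π),
      siteSpin_submatrix_comp, siteSpin_submatrix_comp]
    rfl
  have key : gibbsState β ((anisotropicTorus d L n 1 J₂ J₁).submatrix (fun σ => σ ∘ π) (fun σ => σ ∘ π))
      ((siteSpin n x α * siteSpin n y α).submatrix (fun σ => σ ∘ π) (fun σ => σ ∘ π)) =
      gibbsState β (anisotropicTorus d L n 1 J₂ J₁) (siteSpin n x α * siteSpin n y α) :=
    gibbsState_submatrix_equiv_xyz β (anisotropicTorus d L n 1 J₂ J₁) (siteSpin n x α * siteSpin n y α)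
      (Equiv.arrowCongr π.symm (Equiv.refl (Fin (n + 1))))
  rw [hH, hO] at key
  rw [gibbsSpinCorr, gibbsSpinCorr]
  exact congrArg Complex.re key

/-- **Direction independence of the thermal bond correlations** (B–U (4.33)–(4.34): the
nearest-neighbour correlation "does not depend on the direction"): `Σ_z Gᵅ_β(z, z+eᵢ) = L^d cᵅ(β)`
for every direction `i`. [cite: BjornbergUeltschi2022, (4.33)–(4.34)] -/
theorem xyz_sum_gibbsSpinCorr_dir (hd : 0 < d) (α : Fin 3) (i : Fin d) :
    ∑ z : TorusSite d L, gibbsSpinCorr β (anisotropicTorus d L n 1 J₂ J₁) α z (z + Pi.single i 1) =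
      gibbsBondCorr β (anisotropicTorus d L n 1 J₂ J₁) α * (L : ℝ) ^ d := by
  set H := anisotropicTorus d L n 1 J₂ J₁ with hH_def
  have hL : (0 : ℝ) < (L : ℝ) ^ d := by
    have : (0 : ℝ) < L := by exact_mod_cast Nat.pos_of_ne_zero (NeZero.ne L)
    positivity
  have hd' : (0 : ℝ) < d := by exact_mod_cast hd
  have hdir : ∀ j : Fin d, ∑ z : TorusSite d L, gibbsSpinCorr β H α z (z + Pi.single j 1) =
      ∑ z : TorusSite d L, gibbsSpinCorr β H α z (z + Pi.single i 1) := by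
    intro j
    have hsi : (Equiv.swap j i).symm j = i := by rw [Equiv.symm_swap, Equiv.swap_apply_left]
    calc ∑ z : TorusSite d L, gibbsSpinCorr β H α z (z + Pi.single j 1)
        = ∑ z : TorusSite d L, gibbsSpinCorr β H α (z ∘ Equiv.swap j i)
            ((z ∘ Equiv.swap j i : TorusSite d L) + Pi.single i 1) :=
          sum_congr rfl fun z _ => by
            rw [hH_def, ← xyz_gibbsSpinCorr_comp_perm L n β J₁ J₂ (Equiv.swap j i) α z,
              add_single_comp_perm, hsi]
      _ = ∑ z : TorusSite d L, gibbsSpinCorr β H α z (z + Pi.single i 1) :=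
          (Equiv.arrowCongr (Equiv.swap j i).symm (Equiv.refl (ZMod L))).sum_comp
            (fun z => gibbsSpinCorr β H α z (z + Pi.single i 1))
  rw [gibbsBondCorr, sum_comm, sum_congr rfl fun j _ => hdir j, sum_const, card_univ,
    Fintype.card_fin, nsmul_eq_mul]
  field_simp

end AxisPermutation

/-! ### (Eᵀ) The energy of a coupling triple in the Gibbs state -/

section Energy

variable (L : ℕ) [NeZero L] (n : ℕ) (β : ℝ)

/-- **(Eᵀ)** For the Gibbs state of any Hermitian torus Hamiltonian `H` (`L ≥ 3`, `d ≥ 1`):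
`Re⟨H(a,b,c)⟩_{β,H} = -2dL^d(a c⁰ + b c¹ + c c²)`, `cᵅ = gibbsBondCorr β H α` (B–U's ordered-pair sum
(2.4) counts each bond twice). [cite: BjornbergUeltschi2022, (2.4), (3.8)] -/
theorem re_gibbsState_anisotropicTorus (hL : 3 ≤ L) (hd : 0 < d) {H : Op (TorusSite d L) (n + 1)}
    (hH : H.IsHermitian) (a b c : ℝ) :
    (gibbsState β H (anisotropicTorus d L n a b c)).re =
      -(2 * d * (L : ℝ) ^ d * (a * gibbsBondCorr β H 0 + b * gibbsBondCorr β H 1 +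
        c * gibbsBondCorr β H 2)) := by
  have hdL : (d : ℝ) * (L : ℝ) ^ d ≠ 0 := by
    have : (0 : ℝ) < L := by exact_mod_cast Nat.pos_of_ne_zero (NeZero.ne L)
    have : (0 : ℝ) < d := by exact_mod_cast hd
    positivity
  have hterm : ∀ (x : TorusSite d L) (i : Fin d),
      (gibbsState β H ((a : ℂ) • spinBond n 0 x (x + Pi.single i 1) +
        (b : ℂ) • spinBond n 1 x (x + Pi.single i 1) + (c : ℂ) • spinBond n 2 x (x + Pi.single i 1))).re =
      a * gibbsSpinCorr β H 0 x (x + Pi.single i 1) + b * gibbsSpinCorr β H 1 x (x + Pi.single i 1) +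
        c * gibbsSpinCorr β H 2 x (x + Pi.single i 1) := by
    intro x i
    simp only [map_add, LinearMap.map_smul, smul_eq_mul, Complex.add_re, Complex.re_ofReal_mul,
      re_gibbsState_spinBond' β hH]
  rw [anisotropicTorus_eq_pairSum L n hL a b c, map_neg, map_nsmul, two_nsmul, Complex.neg_re,
    Complex.add_re, map_sum, Complex.re_sum]
  simp only [map_sum, Complex.re_sum, hterm]
  rw [gibbsBondCorr, gibbsBondCorr, gibbsBondCorr]
  simp only [sum_add_distrib, ← mul_sum]
  field_simp
  ring

end Energy

/-! ### (DCᵀ) The Gibbs expectation of the double commutator with a wave of the first component -/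

section DoubleCommutator

variable (L : ℕ) [NeZero L] (n : ℕ) (β : ℝ) (J₁ J₂ : ℝ)

/-- The Gibbs expectation of the double commutator for a real wave, pair by pair:
`Re⟨[A,[H',A]]⟩ = ΣΣ_{x∼y} (J₂((a_x²+a_y²)G¹ - 2a_xa_yG²) + J₁((a_x²+a_y²)G² - 2a_xa_yG¹))(x,y)`.
[cite: BjornbergUeltschi2022, eqs. (4.28)–(4.29)] -/
theorem re_gibbsState_xyz_lie_lie (a : TorusSite d L → ℝ) :
    (gibbsState β (anisotropicTorus d L n 1 J₂ J₁)
      ⁅(∑ u : TorusSite d L, (a u : ℂ) • (siteSpin n u 0 : Op (TorusSite d L) (n + 1))),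
        ⁅anisotropicTorus d L n 1 J₂ J₁,
          ∑ u : TorusSite d L, (a u : ℂ) • (siteSpin n u 0 : Op (TorusSite d L) (n + 1))⁆⁆).re =
      ∑ x : TorusSite d L, ∑ y : TorusSite d L, if (torusGraph d L).Adj x y then
        J₂ * ((a x ^ 2 + a y ^ 2) * gibbsSpinCorr β (anisotropicTorus d L n 1 J₂ J₁) 1 x y -
            2 * a x * a y * gibbsSpinCorr β (anisotropicTorus d L n 1 J₂ J₁) 2 x y) +
          J₁ * ((a x ^ 2 + a y ^ 2) * gibbsSpinCorr β (anisotropicTorus d L n 1 J₂ J₁) 2 x y -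
            2 * a x * a y * gibbsSpinCorr β (anisotropicTorus d L n 1 J₂ J₁) 1 x y)
      else 0 := by
  rw [lie_lie_anisotropicTorus, map_sum, Complex.re_sum]
  refine sum_congr rfl fun x _ => ?_
  rw [map_sum, Complex.re_sum]
  refine sum_congr rfl fun y _ => ?_
  split_ifs with h
  · rw [show ((a x : ℂ) ^ 2 + (a y : ℂ) ^ 2) = ((a x ^ 2 + a y ^ 2 : ℝ) : ℂ) by push_cast; ring,
      show (2 * (a x : ℂ) * (a y : ℂ)) = ((2 * a x * a y : ℝ) : ℂ) by push_cast; ring]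
    simp only [map_add, map_sub, LinearMap.map_smul, smul_eq_mul, Complex.add_re, Complex.sub_re,
      Complex.re_ofReal_mul, gibbsSpinCorr]
  · simp

/-- **The two modes together** (B–U (4.28)–(4.29) at `β < ∞`): for side `L ≥ 3`,
`Re⟨[C_q,[H',C_q]]⟩ + Re⟨[D_q,[H',D_q]]⟩ =
4 Σᵢ Σ_z ((J₂ - J₁ cos qᵢ) G¹(z,z+eᵢ) + (J₁ - J₂ cos qᵢ) G²(z,z+eᵢ))`
(`cos² + sin² = 1`, `cos(q·x)cos(q·y) + sin(q·x)sin(q·y) = cos(q·(x-y))`, ordered pairs are twice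
the bonds `(z, z+eᵢ)`). [cite: BjornbergUeltschi2022, eq. (4.29)] -/
theorem re_gibbsState_xyz_lie_lie_modes (hL : 3 ≤ L) (q : TorusSite d L) :
    (gibbsState β (anisotropicTorus d L n 1 J₂ J₁)
        ⁅xyCosMode L n q, ⁅anisotropicTorus d L n 1 J₂ J₁, xyCosMode L n q⁆⁆).re +
      (gibbsState β (anisotropicTorus d L n 1 J₂ J₁)
        ⁅xySinMode L n q, ⁅anisotropicTorus d L n 1 J₂ J₁, xySinMode L n q⁆⁆).re =
      4 * ∑ i : Fin d, ∑ z : TorusSite d L,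
        ((J₂ - J₁ * Real.cos (latticeMomentum L q i)) *
            gibbsSpinCorr β (anisotropicTorus d L n 1 J₂ J₁) 1 z (z + Pi.single i 1) +
          (J₁ - J₂ * Real.cos (latticeMomentum L q i)) *
            gibbsSpinCorr β (anisotropicTorus d L n 1 J₂ J₁) 2 z (z + Pi.single i 1)) := by
  set H := anisotropicTorus d L n 1 J₂ J₁ with hH_def
  have hH : H.IsHermitian := anisotropicTorus_isHermitian L n 1 J₂ J₁
  rw [xyCosMode, xySinMode, hH_def, re_gibbsState_xyz_lie_lie, re_gibbsState_xyz_lie_lie, ← hH_def,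
    ← sum_add_distrib]
  simp_rw [← sum_add_distrib]
  -- combine the two kernels
  set F : TorusSite d L → TorusSite d L → ℝ := fun x y =>
    2 * ((J₂ - J₁ * Real.cos (torusPhase L q (x - y))) * gibbsSpinCorr β H 1 x y +
      (J₁ - J₂ * Real.cos (torusPhase L q (x - y))) * gibbsSpinCorr β H 2 x y) with hF
  have hcomb : ∀ x y : TorusSite d L,
      ((if (torusGraph d L).Adj x y then
          J₂ * ((Real.cos (torusPhase L q x) ^ 2 + Real.cos (torusPhase L q y) ^ 2) *
              gibbsSpinCorr β H 1 x y -
            2 * Real.cos (torusPhase L q x) * Real.cos (torusPhase L q y) * gibbsSpinCorr β H 2 x y) +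
          J₁ * ((Real.cos (torusPhase L q x) ^ 2 + Real.cos (torusPhase L q y) ^ 2) *
              gibbsSpinCorr β H 2 x y -
            2 * Real.cos (torusPhase L q x) * Real.cos (torusPhase L q y) * gibbsSpinCorr β H 1 x y)
        else 0) +
        (if (torusGraph d L).Adj x y then
          J₂ * ((Real.sin (torusPhase L q x) ^ 2 + Real.sin (torusPhase L q y) ^ 2) *
              gibbsSpinCorr β H 1 x y -
            2 * Real.sin (torusPhase L q x) * Real.sin (torusPhase L q y) * gibbsSpinCorr β H 2 x y) +
          J₁ * ((Real.sin (torusPhase L q x) ^ 2 + Real.sin (torusPhase L q y) ^ 2) *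
              gibbsSpinCorr β H 2 x y -
            2 * Real.sin (torusPhase L q x) * Real.sin (torusPhase L q y) * gibbsSpinCorr β H 1 x y)
        else 0)) =
      if (torusGraph d L).Adj x y then F x y else 0 := by
    intro x y
    split_ifs with h
    · simp only [hF]
      rw [cos_torusPhase_sub]
      linear_combination (J₂ * gibbsSpinCorr β H 1 x y + J₁ * gibbsSpinCorr β H 2 x y) *
          Real.cos_sq_add_sin_sq (torusPhase L q x) +
        (J₂ * gibbsSpinCorr β H 1 x y + J₁ * gibbsSpinCorr β H 2 x y) *
          Real.cos_sq_add_sin_sq (torusPhase L q y)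
    · simp
  simp_rw [hcomb]
  have hFsymm : ∀ x y : TorusSite d L, (torusGraph d L).Adj x y → F x y = F y x := by
    intro x y _
    simp only [hF]
    rw [gibbsSpinCorr_symm β hH 1 x y, gibbsSpinCorr_symm β hH 2 x y, ← neg_sub y x, cos_torusPhase_neg]
  rw [sum_sum_ite_torusGraph_adj hL F hFsymm, sum_comm, nsmul_eq_mul, Nat.cast_ofNat, mul_sum, mul_sum]
  refine sum_congr rfl fun i _ => ?_
  rw [mul_sum, mul_sum]
  refine sum_congr rfl fun z _ => ?_
  simp only [hF]
  rw [sub_add_cancel_left, cos_torusPhase_neg_single]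
  ring

end DoubleCommutator

/-! ### (Aᵀ) Thermal Gaussian domination ⇒ the infrared bound at positive temperature -/

section Infrared

variable (L : ℕ) [NeZero L] (n : ℕ) (J₁ J₂ : ℝ)

/-- **Thermal Gaussian domination ⇒ B–U Lemma 4.4 (infrared bound for the usual correlation
function), in finite volume, every spin.** For `L ≥ 3`, `d ≥ 1`, `β > 0` and a momentum `q ≠ 0`: if
`Z_β(H' - 2V⁰_h + Q(h)·1) ≤ Z_β(H')` for every real field `h` (`H' = H(1,J₂,J₁)`), then `0 ≤ ĝ_q` and
`ĝ_q ≤ 1/(4βE_q) + ½ √(Σᵢ(α' - β'cos qᵢ)/E_q)` with `α' = J₂c¹ + J₁c²`, `β' = J₁c¹ + J₂c²`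
(`cᵅ = gibbsBondCorr β H' α`, `E_q = Σᵢ(1 - cos qᵢ)`). Steps: (1) the Duhamel bound
`(2V⁰_h, 2V⁰_h) ≤ 2Q(h)/β` ([DLS1978] (44)); (2) plane waves, `(C_q,C_q) + (D_q,D_q) ≤ L^d/(4βE_q)`;
(3) Falk–Bruch; (4) the double commutator `= 4L^dΣᵢ(α' - β'cos qᵢ)` ((DCᵀ) and direction
independence). [cite: BjornbergUeltschi2022, Lemma 4.1, Cor. 4.3, Lemma 4.4, (4.26)–(4.34)]
[cite: DLS1978, Thms. 3.1–3.2, 4.1, eq. (44)] -/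
theorem xyz_infraredBound_thermal_of_gd (hL : 3 ≤ L) (hd : 0 < d) {β : ℝ} (hβ : 0 < β)
    (hGD : ∀ h : TorusSite d L → ℝ,
      (partitionFn β (anisotropicTorus d L n 1 J₂ J₁ - (2 : ℂ) • xyGradField L n h +
        ((xyFieldEnergy L h : ℝ) : ℂ) • (1 : Op (TorusSite d L) (n + 1)))).re ≤
        (partitionFn β (anisotropicTorus d L n 1 J₂ J₁)).re)
    (q : TorusSite d L) (hq : q ≠ 0) :
    0 ≤ gibbsStructureFactor β (anisotropicTorus d L n 1 J₂ J₁) 0 q ∧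
      gibbsStructureFactor β (anisotropicTorus d L n 1 J₂ J₁) 0 q ≤
        1 / (4 * β * dispersion (latticeMomentum L q)) +
          1 / 2 * Real.sqrt ((∑ i : Fin d,
            ((J₂ * gibbsBondCorr β (anisotropicTorus d L n 1 J₂ J₁) 1 +
                J₁ * gibbsBondCorr β (anisotropicTorus d L n 1 J₂ J₁) 2) -
              (J₁ * gibbsBondCorr β (anisotropicTorus d L n 1 J₂ J₁) 1 +
                J₂ * gibbsBondCorr β (anisotropicTorus d L n 1 J₂ J₁) 2) *
                Real.cos (latticeMomentum L q i))) /
            dispersion (latticeMomentum L q)) := by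
  -- notation
  set H : Op (TorusSite d L) (n + 1) := anisotropicTorus d L n 1 J₂ J₁ with hH_def
  have hH : H.IsHermitian := anisotropicTorus_isHermitian L n 1 J₂ J₁
  set E : ℝ := dispersion (latticeMomentum L q) with hE_def
  have hE : 0 < E := dispersion_latticeMomentum_pos hq
  set C : Op (TorusSite d L) (n + 1) := xyCosMode L n q with hC_def
  set D : Op (TorusSite d L) (n + 1) := xySinMode L n q with hD_def
  have hC : C.IsHermitian := xyCosMode_isHermitian L n q
  have hD : D.IsHermitian := xySinMode_isHermitian L n q
  have hLd : 0 < (L : ℝ) ^ d := by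
    have : (0 : ℝ) < L := by exact_mod_cast Nat.pos_of_ne_zero (NeZero.ne L)
    positivity
  haveI : Nonempty (TensorIndex (TorusSite d L) (n + 1)) := ⟨fun _ => 0⟩
  set c₁ : ℝ := gibbsBondCorr β H 1 with hc₁_def
  set c₂ : ℝ := gibbsBondCorr β H 2 with hc₂_def
  set Sg : ℝ := ∑ i : Fin d, ((J₂ * c₁ + J₁ * c₂) - (J₁ * c₁ + J₂ * c₂) *
    Real.cos (latticeMomentum L q i)) with hSg_def
  -- (1) the Duhamel infrared bound `(2V_h, 2V_h) ≤ 2Q(h)/β` from Gaussian domination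
  have hDuh : ∀ h : TorusSite d L → ℝ,
      (duhamel β H ((2 : ℂ) • xyGradField L n h) ((2 : ℂ) • xyGradField L n h)).re ≤
        2 * xyFieldEnergy L h / β := by
    intro h
    have hVh : ((2 : ℂ) • xyGradField L n h).IsHermitian := by
      have : ((2 : ℂ) • xyGradField L n h) = (((2 : ℝ) : ℂ) • xyGradField L n h) := by push_cast; rfl
      rw [this]
      exact (xyGradField_isHermitian L n h).ofReal_smul _
    refine gaussianDomination_duhamel_le_holds _ β hβ H _ hH hVh (2 * xyFieldEnergy L h) (fun t => ?_)
    have ht := hGD (t • h)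
    rw [xyGradField_smul, xyFieldEnergy_smul] at ht
    have hform : H - (t : ℂ) • ((2 : ℂ) • xyGradField L n h) +
        ((t ^ 2 * (2 * xyFieldEnergy L h) / 2 : ℝ) : ℂ) • (1 : Op (TorusSite d L) (n + 1)) =
        H - (2 : ℂ) • ((t : ℂ) • xyGradField L n h) +
          (((t ^ 2 * xyFieldEnergy L h : ℝ)) : ℂ) • (1 : Op (TorusSite d L) (n + 1)) := by
      rw [smul_smul, smul_smul, mul_comm (t : ℂ) (2 : ℂ),
        show t ^ 2 * (2 * xyFieldEnergy L h) / 2 = t ^ 2 * xyFieldEnergy L h by ring]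
    rw [hform]
    exact ht
  -- (2) the two modes: `(C,C) + (D,D) ≤ L^d/(4βE)`
  set b₀ : ℝ := (L : ℝ) ^ d / (4 * β * E) with hb₀_def
  have hb₀ : 0 ≤ b₀ := by positivity
  have hmode : ∀ {W : Op (TorusSite d L) (n + 1)} {h : TorusSite d L → ℝ},
      xyGradField L n h = ((2 * E : ℝ) : ℂ) • W →
        (4 * E) ^ 2 * (duhamel β H W W).re ≤ 2 * xyFieldEnergy L h / β := by
    intro W h hVh
    have h1 := hDuh h
    rw [hVh, smul_smul, duhamel_smul_smul, show (2 : ℂ) * ((2 * E : ℝ) : ℂ) * ((2 : ℂ) * ((2 * E : ℝ) : ℂ)) =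
      (((4 * E) ^ 2 : ℝ) : ℂ) by push_cast; ring, Complex.re_ofReal_mul] at h1
    exact h1
  have hb : (duhamel β H C C).re + (duhamel β H D D).re ≤ b₀ := by
    have h1 := hmode (xyGradField_cos L n q)
    have h2 := hmode (xyGradField_sin L n q)
    have hQ := xyFieldEnergy_cos_add_sin L q
    rw [← hE_def] at hQ
    have hsum : (4 * E) ^ 2 * ((duhamel β H C C).re + (duhamel β H D D).re) ≤
        2 * (2 * E * (L : ℝ) ^ d) / β := by
      rw [mul_add, ← hQ, mul_add, add_div]
      exact add_le_add h1 h2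
    rw [hb₀_def, le_div_iff₀ (by positivity)]
    rw [le_div_iff₀ hβ] at hsum
    nlinarith [hsum, hE]
  -- (3) Falk–Bruch for the pair `(C, D)`
  have hA : ∀ k : Fin 2, ((![C, D] : Fin 2 → Op (TorusSite d L) (n + 1)) k).IsHermitian := by
    intro k
    fin_cases k
    · exact hC
    · exact hD
  have hFB := falkBruch_sum_le_of_le hH hβ.le hA (b₀ := b₀)
    (by simpa only [Fin.sum_univ_two, Matrix.cons_val_zero, Matrix.cons_val_one] using hb)
  simp only [Fin.sum_univ_two, Matrix.cons_val_zero, Matrix.cons_val_one] at hFB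
  -- (4) the two sides: `|Λ| ĝ` and the double commutator
  have hlhs : gibbsStructureFactor β H 0 q * (L : ℝ) ^ d =
      (gibbsState β H (C * C)).re + (gibbsState β H (D * D)).re :=
    gibbsStructureFactor_eq_modes β H q
  set c : ℝ := (gibbsState β H (C * (H * C - C * H) - (H * C - C * H) * C)).re +
    (gibbsState β H (D * (H * D - D * H) - (H * D - D * H) * D)).re with hc_def
  have hceq : c = (L : ℝ) ^ d * (4 * Sg) := by
    have h1 := re_gibbsState_xyz_lie_lie_modes L n β J₁ J₂ hL q
    simp only [Ring.lie_def] at h1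
    rw [← hH_def, ← hC_def, ← hD_def] at h1
    rw [hc_def, h1, hSg_def, mul_sum, mul_sum, mul_sum]
    refine sum_congr rfl fun i _ => ?_
    rw [sum_add_distrib, ← mul_sum, ← mul_sum, xyz_sum_gibbsSpinCorr_dir L n β J₁ J₂ hd 1 i,
      xyz_sum_gibbsSpinCorr_dir L n β J₁ J₂ hd 2 i, ← hH_def, ← hc₁_def, ← hc₂_def]
    ring
  -- (5) positivity of `ĝ`
  have haC : 0 ≤ (gibbsState β H (C * C)).re := re_gibbsState_mul_self_nonneg' β hH hC
  have haD : 0 ≤ (gibbsState β H (D * D)).re := re_gibbsState_mul_self_nonneg' β hH hD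
  have hg0 : 0 ≤ gibbsStructureFactor β H 0 q := by
    have h0 : 0 ≤ gibbsStructureFactor β H 0 q * (L : ℝ) ^ d := by
      rw [hlhs]; exact add_nonneg haC haD
    exact nonneg_of_mul_nonneg_left h0 hLd
  refine ⟨hg0, ?_⟩
  -- (6) assemble: `|Λ|ĝ ≤ b₀ + ½√(βb₀c) = b₀ + ½ |Λ| √(Sg/E)`
  have hc0 : 0 ≤ c := add_nonneg (hH.re_gibbsState_doubleComm_nonneg hC hβ.le)
    (hH.re_gibbsState_doubleComm_nonneg hD hβ.le)
  have hSg0 : 0 ≤ Sg := by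
    have : 0 ≤ (L : ℝ) ^ d * (4 * Sg) := hceq ▸ hc0
    nlinarith
  have hsqrt : Real.sqrt (β * b₀ * c) = (L : ℝ) ^ d * Real.sqrt (Sg / E) := by
    have h1 : β * b₀ * c = ((L : ℝ) ^ d) ^ 2 * (Sg / E) := by
      rw [hceq, hb₀_def]
      field_simp
    rw [h1, Real.sqrt_mul (sq_nonneg _), Real.sqrt_sq hLd.le]
  have hmain : gibbsStructureFactor β H 0 q * (L : ℝ) ^ d ≤
      b₀ + 1 / 2 * ((L : ℝ) ^ d * Real.sqrt (Sg / E)) := by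
    rw [hlhs, ← hsqrt]
    exact hFB
  have hb₀' : b₀ = (L : ℝ) ^ d * (1 / (4 * β * E)) := by rw [hb₀_def]; ring
  rw [hb₀'] at hmain
  have hfin : gibbsStructureFactor β H 0 q * (L : ℝ) ^ d ≤
      (1 / (4 * β * E) + 1 / 2 * Real.sqrt (Sg / E)) * (L : ℝ) ^ d := by
    calc gibbsStructureFactor β H 0 q * (L : ℝ) ^ d
        ≤ (L : ℝ) ^ d * (1 / (4 * β * E)) + 1 / 2 * ((L : ℝ) ^ d * Real.sqrt (Sg / E)) := hmain
      _ = (1 / (4 * β * E) + 1 / 2 * Real.sqrt (Sg / E)) * (L : ℝ) ^ d := by ring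
  exact le_of_mul_le_mul_right hfin hLd

/-- **The infrared bound at positive temperature for the anisotropic nearest-neighbour model**
(B–U Lemma 4.4, as printed — `β < ∞`): on the even torus `(ℤ/Lℤ)^d` of side `L ≥ 4`, `d ≥ 1`, for
every spin `n/2`, couplings `0 ≤ J₁`, `J₂ ≤ 0` (third coupling `1`), every `β > 0` and momentum
`q ≠ 0`: `0 ≤ ĝ_q ≤ 1/(4βE_q) + ½ √(Σᵢ(α' - β'cos qᵢ)/E_q)` for the thermal structure factor of
the first component of `H(1,J₂,J₁)`. Unconditional: thermal Gaussian domination is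
`bu_thermalGaussianDomination`. [cite: BjornbergUeltschi2022, Lemma 4.4, Cor. 5.3]
[cite: DLS1978, eq. (44), Thms. 3.1–3.2] -/
theorem xyz_infraredBound_thermal (hLe : Even L) (hL4 : 4 ≤ L) (hd : 0 < d) {β : ℝ} (hβ : 0 < β)
    (hJ₁ : 0 ≤ J₁) (hJ₂ : J₂ ≤ 0) (q : TorusSite d L) (hq : q ≠ 0) :
    0 ≤ gibbsStructureFactor β (anisotropicTorus d L n 1 J₂ J₁) 0 q ∧
      gibbsStructureFactor β (anisotropicTorus d L n 1 J₂ J₁) 0 q ≤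
        1 / (4 * β * dispersion (latticeMomentum L q)) +
          1 / 2 * Real.sqrt ((∑ i : Fin d,
            ((J₂ * gibbsBondCorr β (anisotropicTorus d L n 1 J₂ J₁) 1 +
                J₁ * gibbsBondCorr β (anisotropicTorus d L n 1 J₂ J₁) 2) -
              (J₁ * gibbsBondCorr β (anisotropicTorus d L n 1 J₂ J₁) 1 +
                J₂ * gibbsBondCorr β (anisotropicTorus d L n 1 J₂ J₁) 2) *
                Real.cos (latticeMomentum L q i))) /
            dispersion (latticeMomentum L q)) :=
  xyz_infraredBound_thermal_of_gd L n J₁ J₂ (by omega) hd hβ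
    (fun h => bu_thermalGaussianDomination L n hLe hL4 hβ hJ₁ hJ₂ h) q hq

end Infrared

end Literature.MathematicalPhysics.QuantumLattice

end
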